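import Summits.HodgeConjecture.HodgeConjecture.Theses.FirstOrderSemiregularSeeds
import Literature.AlgebraicGeometry.Deformation.VectorBundleLifting
import Literature.AlgebraicGeometry.FormalGeometry.FormalNeighbourhoodTower
import HarnessLib
import HarnessLib.Audit

/-!
# Line `birth` (BC3 / BC5 PLAN-ONLY skeleton) — crux `FirstOrderSemiregularSeeds.FirstOrderSemiregularTransfer` (X1)
# (item stmt-HodgeConjecture-22979, route route-HodgeConjecture-FirstOrderSemiregularSeeds rev 3 765d0d4f8ced) — v1
# (tribunal-w bc5-witness planner `hodge-fos-w-1` g0, 2026-08-27; tribunal round 1 J verdict 23597fb153a82890 F2;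
#  NO prover is seated on X1 — this file registers the line only)

HONEST FRAMING. Nothing in this file proves X1, X2′, rung H2 (`SevenfoldWeilCensus.WeilSixfolds`), HC for abelian
varieties or the Hodge conjecture. Three statements are SORRIED STUBS; everything else is packaging proved here.

Crux (VERBATIM the route decl, concluded BY NAME below): `FirstOrderSemiregularTransfer := ∀ C, LocalVariationalHodgeFor 𝒪_C`
— for every Chern-character theory `C`, in every smooth projective family `π : 𝒳 → S` over a smooth base, `U` cohomologically
locally trivial, `s₀ ∈ U`, model `e : X₀ ≅ 𝒳_{s₀}`: IF `κ` is `𝒪_C`-admissible (an f.l.f. `E₀` on the ABELIAN fibre `X₀`,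
`κ_p = ch_p(E₀)` for all `p ≤ n`, lifting to first order — over every square-zero Artinian point of the base — along every
smooth projective family through `X₀` on which `ch(E₀)` stays Hodge) and the transports of all `κ_p` stay of type `(p,p)` on
`U`, THEN they are ALGEBRAIC on a neighbourhood of `s₀`.  `𝒪_C` is NAMED here `foClass C` (same lambda; `Iff.rfl` check
`firstOrderSemiregularTransfer_iff`).

## Placement (tribunal T2/T5, recorded): BEK 2014 (Bloch–Esnault–Kerz, arXiv:1310.1773) Thm. 2 makes CLASS-level FORMAL
lifting free on abelian schemes; ALGEBRAISATION of formal classes is their open Question 5 / Appendix; printed transfer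
theorems all assume σ-injectivity (Bloch 1972; Buchweitz–Flenner 2003 Thm. 5.1; Pridham 2024 Cor. 2.25; Bandiera–Lepri–
Manetti 2023 Cor. 1.1 = obstructions lie in `ker σ`).  Hence X1's CONTENT = OBJECT-level ABSORPTION for honest bundles
(a compatible system of vector bundles, which Grothendieck existence CAN algebraise) — the stubs below cut exactly there.

## Why-clause (tribunal T3 / BC5 — PLAN-ONLY; flag `T3-plan-only` expected)
RUNG DESIGNATE = `stub_absorption_bundle_abelian_toy` (J's name): FIRST ORDER ⟹ SECOND ORDER, class level, for the named
bundle class `𝒪_C` (finite locally free, abelian fibre, first-order liftable along every Hodge family of its Chern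
character): along every such family SOME f.l.f. sheaf with the same Chern character extends over the SECOND infinitesimal
neighbourhood `𝒳 ×_S Spec(𝒪_S/𝔪³)` of the fibre (`LiftsToOrderAlong … 2`, the `∃`-form — the lift may be re-chosen, the
object may be replaced within its class; NOT the `∀F` formal-smoothness form `LiftsOverArtinianPointsAt`, which along the
TRIVIAL family would force `Def(E₀)` smooth).  WHY IT IS A WITNESS OF THE LEVER AND NOT OF S: its conclusion is
deformation-theoretic (a second-order lift exists), decided by NO case of HC (HC in dim ≤ 3 decides X1|threefolds — J round 1:
no credit — but says nothing about lifting a bundle to order 2); its hypothesis IS the lever (drop first-order liftability and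
it is false at order 1: `L ⊕ L⁻¹` on a Weil-type fibre, `ch = (2, 0, c₁(L)², …)` stays Hodge while `c₁(L)` does not); it is
the first rung of `stub_absorption_bundle_abelian` (all orders), PROVED below to follow from it (`toy_of_absorption`).
NAMED TECHNIQUE: the second obstruction `o₂(F₁) ∈ Ext²(E₀,E₀) ⊗ 𝔪²/𝔪³` of a first-order lift `F₁` lies in `ker σ`
(Bandiera–Lepri–Manetti Cor. 1.1 / Pridham §2, relative form) and changes under `F₁ ↦ F₁ + η`, `η ∈ Ext¹(E₀,E₀) ⊗ 𝔪/𝔪²`, by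
the Yoneda square `η ∪ η` plus `[η, ·]`-terms; ABSORPTION = on an abelian fibre the `ker σ`-part reachable this way (with the
`Pic⁰ × translation` symmetries, Mukai's Fourier transform exchanging `H¹(𝒪)`- and `H⁰(T)`-directions) covers `o₂` — to be
established first for the X2′ design class on the CM anchor by direct computation (instrument engine, order-2 extension of
kit j292340's row test), then in general.

## The line: FIRST-ORDER ⟹ FORMAL (object level, class may re-choose the object) ⟹ ALGEBRAIC (Grothendieck existence + Artin)

REGISTERED STUBS (sorried; `propose --supports stmt-HodgeConjecture-22979` proving one BY NAME + SIGNATURE; no prover is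
seated on X1 by the tribunal's ruling — idle / strategist work only):
* `stub_absorption_bundle_abelian_toy` — THE RUNG (above).  Size L.  WHY IT MIGHT FAIL: a first-order-liftable class on an
  abelian fibre all of whose f.l.f. representatives have non-zero second obstruction for every first-order lift (the
  object-level shadow is real: the prior programme's `O_D` on `Bl₂₂ℙ²` satisfies (W) and has no flat extension — not an
  abelian fibre; torsion-free rank-one sheaves on abelian threefolds satisfy (W) without being semiregular — prior Theorem C,
  no deformation claim).  Sources: BandieraLepriManetti2023 Cor. 1.1; Pridham2024Semiregularity §2; FantechiManetti1999T1Lifting;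
  Mukai1978SemiHomogeneous; BlochEsnaultKerz2014CharZero Thm. 2.
* `stub_absorption_bundle_abelian` — ALL ORDERS: `foClass C ⊆ formalClass C` — the classes of a first-order-liftable f.l.f.
  sheaf on an abelian fibre are the classes of an f.l.f. sheaf that extends to a FORMAL vector bundle on the completion of
  `𝒳` along the fibre (`LiftsFormally` along the canonical tower `𝒳 ×_S Spec(𝒪_S/𝔪^{m+1})`), for every Hodge family.
  THE CRUX'S OPEN HEART (class-level weak semiregularity, object-level output).  Size XL.  WHY IT MIGHT FAIL: as for the toy,
  at some finite order; a counterexample is a counterexample to the object-supply half of the variational Hodge conjecture for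
  bundles on abelian schemes with first-order-unobstructed representative — none known.  Sources: as above + Markman2025SurveySecant Q 11.4.
* `stub_algebraise_formalLift` — `LocalVariationalHodgeFor (formalClass C)`: a formally liftable f.l.f. sheaf on the fibre of a
  smooth projective family whose `ch` stays Hodge on `U` has ALGEBRAIC transports near `s₀`.  IN PRINT modulo typing:
  Grothendieck existence for coherent sheaves on `𝒳 ×_S Spec 𝒪̂_{S,s₀}` (projective), Artin approximation to an étale
  neighbourhood (agreement to order ≥ 0 suffices for classes), `ch` locally constant, then the venture's pointwise spread
  `exists_nbhd_transportFun_mem_algebraicClasses_of_etale`.  Size L (tree: `GrothendieckExistenceVectorBundles*`,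
  `AmplificationChainPridham` §1–2 give the two halves' shapes).  WHY IT MIGHT FAIL: only by a typing slip (the canonical tower of
  `ker (X₀ → 𝒳)` must be the tower of thickened fibres: `π` flat, `s₀` a closed point — true for smooth `π` over smooth `S`).
  Sources: FGAExplained2005 Thm. 8.4.2; Artin1969 Thm. 1.12; SGA1 XII; BuchweitzFlenner2003 proof of Thm. 5.1.

COMPOSITION (kernel-checked, no sorry outside the stubs): `localVariationalHodgeFor_foClass_of : ‹absorption› → ‹algebraise› →
∀ C, LocalVariationalHodgeFor (foClass C)` := `LocalVariationalHodgeFor.anti` (monotonicity of the venture predicate in the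
object class), and `FirstOrderSemiregularTransfer_of : FirstOrderSemiregularTransfer` := that ▸ `Iff.rfl` with the stubs plugged in.  Both binders are LOAD-BEARING; the toy is ON PATH (`toy_of_absorption : ‹absorption› → ‹toy›`, proved).

## Disproof / negatives used
No `Cruxes/FirstOrderSemiregularTransfer/Disproof.lean` exists.  `ledger negatives --problem HodgeConjecture`: none on this
technique class.  Recorded dead readings honoured: the OBJECT-level weak criterion for arbitrary torsion-free sheaves / on
rational surfaces (prior programme) — every stub keeps «abelian fibre ∧ finite locally free» and the class-level `∃`.
The `∀F`-form (`LiftsOverArtinianPointsAt`, formal smoothness) is deliberately NOT used: along the trivial family it would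
demand `Def(E₀)` smooth (false for `𝒪²` on an abelian surface: commuting-variety singularity), an artefact, not the question.

## References
[cite: BlochEsnaultKerz2014CharZero, Thm. 2, Question 5, Cor. 6, Appendix] [cite: Markman2025SurveySecant, Q 11.4, Lemma 11.3, §12]
[cite: BuchweitzFlenner2003, Thm. 5.1 and its proof, Thm. 6.7] [cite: BandieraLepriManetti2023, Cor. 1.1] [cite: Pridham2024Semiregularity, Cor. 2.25, §2]
[cite: FantechiManetti1999T1Lifting, Thm. A] [cite: Mukai1978SemiHomogeneous, §3–§5] [cite: FGAExplained2005, Thm. 8.4.2] [cite: Artin1969, Thm. 1.12]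
[cite: VoisinTorino1994, Lecture 7 p. 150]
-/

noncomputable section

-- single-problem summit (Problem = Summit): the mandated namespace repeats `HodgeConjecture`.
set_option linter.dupNamespace false

open CategoryTheory AlgebraicGeometry
open Literature.AlgebraicGeometry Literature.AlgebraicGeometry.Motives Literature.AlgebraicGeometry.HodgeTheory
open Literature.AlgebraicGeometry.Deformation Literature.AlgebraicGeometry.FormalGeometry
open Literature.AlgebraicTopology.SingularHomology
open Summit.Ventures.HSemireg

namespace Summit.HodgeConjecture.HodgeConjecture.Cruxes.FirstOrderSemiregularTransfer.Birth

universe u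

/-! ## §0 `𝒪_C` named; lifting to order `m` / formally ALONG A FAMILY at a point (the `∃`-forms) -/

/-- **`𝒪_C` NAMED** — VERBATIM the object class inlined in the route decl `FirstOrderSemiregularTransfer` (checked by `Iff.rfl`
in `firstOrderSemiregularTransfer_iff`). [cite: Markman2025SurveySecant, Q 11.4 (first-order reading)] -/
def foClass (C : ChernCharacterBetti) : ObjClass :=
  fun (n : ℕ) (X₀ : Literature.AlgebraicGeometry.Motives.SchemeOver ℂ) (I : Finset ℕ) (κ : (p : ℕ) → Literature.AlgebraicGeometry.HodgeTheory.complexBetti X₀ (2 * p)) => I = Finset.range (n + 1) ∧ (∃ P₀ : Literature.AlgebraicGeometry.Motives.AbelianVariety ℂ, Nonempty (X₀ ≅ P₀.X)) ∧ ∃ (E₀ : X₀.left.Modules) (_ : Literature.AlgebraicGeometry.Motives.IsFiniteLocallyFree E₀), (∀ p ∈ I, κ p = C.ch X₀ E₀ p) ∧ ∀ ⦃𝒳 S : Literature.AlgebraicGeometry.Motives.SchemeOver ℂ⦄ (π : 𝒳 ⟶ S), Literature.AlgebraicGeometry.Motives.IsSmoothProjectiveFamily π n → AlgebraicGeometry.Smooth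 S.hom → ∀ ⦃U : Set (Literature.AlgebraicGeometry.Motives.ComplexPoints S)⦄ (hU : Literature.AlgebraicGeometry.HodgeTheory.IsCohomologicallyLocallyTrivialOn π U) (s₀ : U) (e : X₀ ≅ Literature.AlgebraicGeometry.Motives.fiberOver π s₀.1), (∀ p ∈ Finset.range (n + 1), ∀ (t : U) (γ : Path.Homotopic.Quotient s₀ t), Literature.AlgebraicGeometry.HodgeTheory.IsOfHodgeType n (Literature.AlgebraicGeometry.Motives.fiberOver π t.1) (2 * p) p p (Literature.AlgebraicGeometry.HodgeTheory.transportFun π (2 * p) hU γ (Literature.AlgebraicGeometry.HodgeTheory.complexBetti.map e.inv (2 * p) (C.ch X₀ E₀ p)))) → ∀ (A B : Type) [CommRing A] [Algebra ℂ A] [IsArtinianRing A] [IsLocalRing A] [CommRing B] [Algebra ℂ B] (f : A →ₐ[ℂ] B), Function.Surjective f → IsLocalRing.maximalIdeal A * IsLocalRing.maximalIdeal A = ⊥ → ∀ (ρ : B →ₐ[ℂ] ℂ) (a : Literature.AlgebraicGeometry.Motives.specOver ℂ A ⟶ S), CategoryTheory.CategoryStruct.comp (AlgebraicGeometry.Spec.map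 (CommRingCat.ofHom (ρ.comp f).toRingHom)) a.left = s₀.1.left → ∀ ⦃XA XB : AlgebraicGeometry.Scheme⦄ (gA : XA ⟶ 𝒳.left) (qA : XA ⟶ AlgebraicGeometry.Spec (CommRingCat.of A)), CategoryTheory.IsPullback gA qA π.left a.left → ∀ (i : XB ⟶ XA) (qB : XB ⟶ AlgebraicGeometry.Spec (CommRingCat.of B)), CategoryTheory.IsPullback i qB qA (AlgebraicGeometry.Spec.map (CommRingCat.ofHom f.toRingHom)) → ∀ (j : X₀.left ⟶ XB), CategoryTheory.IsPullback j X₀.hom qB (AlgebraicGeometry.Spec.map (CommRingCat.ofHom ρ.toRingHom)) → CategoryTheory.CategoryStruct.comp j (CategoryTheory.CategoryStruct.comp i gA) = CategoryTheory.CategoryStruct.comp e.hom.left (Literature.AlgebraicGeometry.Motives.fiberι π s₀.1).left → ∀ (F : XB.Modules), Literature.AlgebraicGeometry.Motives.IsVectorBundle F → Nonempty ((AlgebraicGeometry.Scheme.Modules.pullback j).obj F ≅ E₀) → Literature.AlgebraicGeometry.Deformation.LiftsAlong i F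

/-- The route crux IS `∀ C, LocalVariationalHodgeFor (foClass C)` — definitionally. -/
theorem firstOrderSemiregularTransfer_iff :
    Summit.HodgeConjecture.HodgeConjecture.Theses.FirstOrderSemiregularSeeds.FirstOrderSemiregularTransfer ↔
      ∀ C : ChernCharacterBetti, LocalVariationalHodgeFor (foClass C) :=
  Iff.rfl

section Along

variable {𝒳 S : SchemeOver ℂ} (π : 𝒳 ⟶ S) (s₀ : ComplexPoints S) (X₀ : SchemeOver ℂ) (e : X₀ ≅ fiberOver π s₀)
  (E₀ : X₀.left.Modules)

/-- The fibre-inclusion `X₀ ≅ 𝒳_{s₀} ↪ 𝒳` as a morphism of schemes. -/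
abbrev fibreIncl : X₀.left ⟶ 𝒳.left := (e.hom ≫ fiberι π s₀).left

/-- **`E₀` lifts to ORDER `m` along `π` at `s₀`** (`∃`-form): some vector bundle on the `m`-th infinitesimal neighbourhood
`Y_m = V(𝓘^{m+1})` of the fibre in `𝒳` (`𝓘 = ker (X₀ → 𝒳)`; for `π` flat and `s₀` closed, `Y_m = 𝒳 ×_S Spec(𝒪_S/𝔪^{m+1})`),
CANONICAL tower, restricts to `E₀`.  `m = 1`: first order; `m = 2`: second order. [cite: FantechiManetti1999T1Lifting, §1]
[cite: Hartshorne1977, II.9 (infinitesimal neighbourhoods)] -/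
def LiftsToOrderAlong (m : ℕ) : Prop :=
  ∃ E : ((FormalNeighbourhoodTower.canonical (fibreIncl π s₀ X₀ e).ker).obj m).Modules,
    IsVectorBundle E ∧
      Nonempty ((Scheme.Modules.pullback
        ((FormalNeighbourhoodTower.canonical (fibreIncl π s₀ X₀ e).ker).incl (fibreIncl π s₀ X₀ e) m)).obj E ≅ E₀)

/-- **`E₀` lifts FORMALLY along `π` at `s₀`** (`∃`-form): a compatible system of vector bundles on all infinitesimal
neighbourhoods of the fibre — the tree's `Deformation.LiftsFormally` for the fibre inclusion and the canonical tower (a formal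
vector bundle on the completion `𝒳̂` along `𝒳_{s₀}`, the input of Grothendieck existence). [cite: FGAExplained2005, §8.4]
[cite: Cesnavicius2020GLVectorBundles, §2] -/
def LiftsFormallyAlong : Prop :=
  LiftsFormally (fibreIncl π s₀ X₀ e) (FormalNeighbourhoodTower.canonical (fibreIncl π s₀ X₀ e).ker) E₀

variable {π s₀ X₀ e E₀}

/-- A formal lift restricts to a lift of every finite order. [folklore] -/
theorem liftsToOrderAlong_of_liftsFormallyAlong (h : LiftsFormallyAlong π s₀ X₀ e E₀) (m : ℕ) :
    LiftsToOrderAlong π s₀ X₀ e E₀ m := by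
  obtain ⟨E, hE, -, hiso⟩ := h.exists_forall_iso
  exact ⟨E m, hE m, hiso m⟩

end Along

/-! ## §1 The intermediate object classes: second-order liftable / formally liftable f.l.f. designs on abelian fibres -/

/-- **`𝒪_C` at ORDER 2** — the base data of `𝒪_C` (abelian fibre, f.l.f. `E₀`, `κ = ch(E₀)` on `I = {0,…,n}`) and: along every
smooth projective family through `X₀` on which `ch(E₀)` stays Hodge, `E₀` lifts to SECOND order (`LiftsToOrderAlong … 2`).
[cite: FantechiManetti1999T1Lifting, §1] -/
def soClass (C : ChernCharacterBetti) : ObjClass :=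
  fun (n : ℕ) (X₀ : Literature.AlgebraicGeometry.Motives.SchemeOver ℂ) (I : Finset ℕ) (κ : (p : ℕ) → Literature.AlgebraicGeometry.HodgeTheory.complexBetti X₀ (2 * p)) => I = Finset.range (n + 1) ∧ (∃ P₀ : Literature.AlgebraicGeometry.Motives.AbelianVariety ℂ, Nonempty (X₀ ≅ P₀.X)) ∧ ∃ (E₀ : X₀.left.Modules) (_ : Literature.AlgebraicGeometry.Motives.IsFiniteLocallyFree E₀), (∀ p ∈ I, κ p = C.ch X₀ E₀ p) ∧ ∀ ⦃𝒳 S : Literature.AlgebraicGeometry.Motives.SchemeOver ℂ⦄ (π : 𝒳 ⟶ S), Literature.AlgebraicGeometry.Motives.IsSmoothProjectiveFamily π n → AlgebraicGeometry.Smooth S.hom → ∀ ⦃U : Set (Literature.AlgebraicGeometry.Motives.ComplexPoints S)⦄ (hU : Literature.AlgebraicGeometry.HodgeTheory.IsCohomologicallyLocallyTrivialOn π U) (s₀ : U) (e : X₀ ≅ Literature.AlgebraicGeometry.Motives.fiberOver π s₀.1), (∀ p ∈ Finset.range (n + 1), ∀ (t : U) (γ : Path.Homotopic.Quotient s₀ t),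 Literature.AlgebraicGeometry.HodgeTheory.IsOfHodgeType n (Literature.AlgebraicGeometry.Motives.fiberOver π t.1) (2 * p) p p (Literature.AlgebraicGeometry.HodgeTheory.transportFun π (2 * p) hU γ (Literature.AlgebraicGeometry.HodgeTheory.complexBetti.map e.inv (2 * p) (C.ch X₀ E₀ p)))) → LiftsToOrderAlong π s₀.1 X₀ e E₀ 2

/-- **`𝒪_C` FORMALLY** — the same with a FORMAL lift (`LiftsFormallyAlong`) along every Hodge family. [cite: FGAExplained2005, §8.4] -/
def formalClass (C : ChernCharacterBetti) : ObjClass :=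
  fun (n : ℕ) (X₀ : Literature.AlgebraicGeometry.Motives.SchemeOver ℂ) (I : Finset ℕ) (κ : (p : ℕ) → Literature.AlgebraicGeometry.HodgeTheory.complexBetti X₀ (2 * p)) => I = Finset.range (n + 1) ∧ (∃ P₀ : Literature.AlgebraicGeometry.Motives.AbelianVariety ℂ, Nonempty (X₀ ≅ P₀.X)) ∧ ∃ (E₀ : X₀.left.Modules) (_ : Literature.AlgebraicGeometry.Motives.IsFiniteLocallyFree E₀), (∀ p ∈ I, κ p = C.ch X₀ E₀ p) ∧ ∀ ⦃𝒳 S : Literature.AlgebraicGeometry.Motives.SchemeOver ℂ⦄ (π : 𝒳 ⟶ S), Literature.AlgebraicGeometry.Motives.IsSmoothProjectiveFamily π n → AlgebraicGeometry.Smooth S.hom → ∀ ⦃U : Set (Literature.AlgebraicGeometry.Motives.ComplexPoints S)⦄ (hU : Literature.AlgebraicGeometry.HodgeTheory.IsCohomologicallyLocallyTrivialOn π U) (s₀ : U) (e : X₀ ≅ Literature.AlgebraicGeometry.Motives.fiberOver π s₀.1), (∀ p ∈ Finset.range (n + 1), ∀ (t : U) (γ : Path.Homotopic.Quotient s₀ t),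 Literature.AlgebraicGeometry.HodgeTheory.IsOfHodgeType n (Literature.AlgebraicGeometry.Motives.fiberOver π t.1) (2 * p) p p (Literature.AlgebraicGeometry.HodgeTheory.transportFun π (2 * p) hU γ (Literature.AlgebraicGeometry.HodgeTheory.complexBetti.map e.inv (2 * p) (C.ch X₀ E₀ p)))) → LiftsFormallyAlong π s₀.1 X₀ e E₀

/-- Formally liftable designs are second-order liftable (restrict the compatible system). [folklore] -/
theorem soClass_of_formalClass (C : ChernCharacterBetti) :
    ∀ n X₀ I κ, formalClass C n X₀ I κ → soClass C n X₀ I κ := by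
  rintro n X₀ I κ ⟨hI, hP, E₀, hE₀, hch, hlift⟩
  exact ⟨hI, hP, E₀, hE₀, hch, fun 𝒳 S π hπ hS U hU s₀ e hHodge =>
    liftsToOrderAlong_of_liftsFormallyAlong (hlift π hπ hS hU s₀ e hHodge) 2⟩

/-! ## §2 Registered stubs -/

/-- **STUB T — THE RUNG (BC5 / T3 PLAN-ONLY; J's designate `stub_absorption_bundle_abelian_toy`): FIRST ORDER ⟹ SECOND ORDER,
class level, for the bundle class `𝒪_C` on abelian fibres** (`foClass C ⊆ soClass C`).  Technique and why it might fail: module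
docstring.  ON PATH: `toy_of_absorption`. [cite: BandieraLepriManetti2023, Cor. 1.1] [cite: Pridham2024Semiregularity, §2]
[cite: FantechiManetti1999T1Lifting, Thm. A] [cite: Mukai1978SemiHomogeneous, §3] -/
theorem stub_absorption_bundle_abelian_toy (C : ChernCharacterBetti) :
    ∀ n X₀ I κ, foClass C n X₀ I κ → soClass C n X₀ I κ := by
  sorry

/-- **STUB A — ABSORPTION, ALL ORDERS (the crux's open heart): `foClass C ⊆ formalClass C`** — the classes of a first-order
liftable f.l.f. sheaf on an abelian fibre are the classes of a FORMALLY liftable one, along every Hodge family.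
[cite: BlochEsnaultKerz2014CharZero, Thm. 2 (class-level formal lifting) and Question 5] [cite: Markman2025SurveySecant, Q 11.4]
[cite: BandieraLepriManetti2023, Cor. 1.1] -/
theorem stub_absorption_bundle_abelian (C : ChernCharacterBetti) :
    ∀ n X₀ I κ, foClass C n X₀ I κ → formalClass C n X₀ I κ := by
  sorry

/-- **STUB G — ALGEBRAISATION OF A FORMAL LIFT (in print modulo typing): `LocalVariationalHodgeFor (formalClass C)`** —
Grothendieck existence on `𝒳 ×_S Spec 𝒪̂_{S,s₀}`, Artin approximation to an étale neighbourhood, local constancy of `ch`, and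
the venture's pointwise spread `exists_nbhd_transportFun_mem_algebraicClasses_of_etale`.
[cite: FGAExplained2005, Thm. 8.4.2] [cite: Artin1969, Thm. 1.12] [cite: BuchweitzFlenner2003, proof of Thm. 5.1] -/
theorem stub_algebraise_formalLift (C : ChernCharacterBetti) : LocalVariationalHodgeFor (formalClass C) := by
  sorry

/-! ## §3 The ladder and the composition (no sorry below) -/

/-- The rung follows from absorption, statementwise (so STUB T is ON PATH). -/
theorem toy_of_absorption
    (hA : ∀ (C : ChernCharacterBetti) n X₀ I κ, foClass C n X₀ I κ → formalClass C n X₀ I κ)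
    (C : ChernCharacterBetti) : ∀ n X₀ I κ, foClass C n X₀ I κ → soClass C n X₀ I κ :=
  fun n X₀ I κ h => soClass_of_formalClass C n X₀ I κ (hA C n X₀ I κ h)

/-- **COMPOSITION, hypothesis-explicit form: absorption ∧ algebraisation ⟹ the crux's definitional content**
`∀ C, LocalVariationalHodgeFor (foClass C)` (= the crux by `firstOrderSemiregularTransfer_iff`), by monotonicity of
`LocalVariationalHodgeFor` in the object class. Both binders are consumed. (Stated on the unfolded form so that EXACTLY ONE
theorem of this file — `FirstOrderSemiregularTransfer_of` below — concludes the crux constant by name, as the skeleton audit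
requires.) -/
theorem localVariationalHodgeFor_foClass_of
    (hA : ∀ (C : ChernCharacterBetti) n X₀ I κ, foClass C n X₀ I κ → formalClass C n X₀ I κ)
    (hG : ∀ C : ChernCharacterBetti, LocalVariationalHodgeFor (formalClass C)) :
    ∀ C : ChernCharacterBetti, LocalVariationalHodgeFor (foClass C) :=
  fun C => (hG C).anti (hA C)

/-- **THE SKELETON THEOREM: the crux, concluded BY NAME, from the REGISTERED STUBS** (absorption + algebraisation; the toy is
their proved consequence, on path). The only theorem of this file whose conclusion is the crux constant; `closed = false`
until the stubs are proved. -/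
theorem FirstOrderSemiregularTransfer_of :
    Summit.HodgeConjecture.HodgeConjecture.Theses.FirstOrderSemiregularSeeds.FirstOrderSemiregularTransfer :=
  firstOrderSemiregularTransfer_iff.mpr
    (localVariationalHodgeFor_foClass_of stub_absorption_bundle_abelian stub_algebraise_formalLift)

end Summit.HodgeConjecture.HodgeConjecture.Cruxes.FirstOrderSemiregularTransfer.Birth

end
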